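import Summits.Parity.GeneralizedHardyLittlewood.Theses.ClassVarianceLadder

/-!
# Line `birth` — elaborating skeleton for the crux `MobiusCofactorAtom`
(item stmt-Parity-13833, route `ClassVarianceLadder` = route-Parity-ClassVarianceLadder,
sub-problem `GeneralizedHardyLittlewood`; registrar planner-skel-stmt-Parity-13833-0, 2026-08-17)

Crux (by name, concluded by `MobiusCofactorAtom_of` below — hypothesis form, real proof — and
instantiated on the stubs by `MobiusCofactorAtom_of_stubs`):
`Summit.Parity.GeneralizedHardyLittlewood.Theses.ClassVarianceLadder.MobiusCofactorAtom` — for every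
`t ≥ 1`, `L`, `A > 0` there are `δ > 0`, `N₀` with: for `N ≥ N₀`, every non-degenerate system `Ψ` of
`t+1` affine forms on `ℤ` with `‖Ψ‖_N ≤ L`, every `[u,v] ⊆ [−N,N]`,
`Σ_{1 ≤ m ≤ N^δ} log m · |S_Ψ(m; u, v)| ≤ N/(log N)^A`, where
`S_Ψ(m; u, v) = Σ_{n ∈ [u,v], ψ_{t+1}(n) ≥ 1, m ∣ ψ_{t+1}(n)} μ(ψ_{t+1}(n)/m) · Π_{i ≤ t} Λ(ψ_i(n))`
("the Möbius function of the COFACTOR of the opened form does not correlate with primality of the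
other `t` forms, ℓ¹ over dilations `m ≤ N^δ`", uniform in shifts `≤ LN` and intervals).

## The line: REGIME SPLIT OF THE DILATION — Siegel–Walfisz range (pointwise) / Bombieri–Vinogradov range (in mean)

The crux carries three uniformities at once: the ℓ¹-range of the dilation `m ≤ N^δ`, the shift
uniformity `‖Ψ‖_N ≤ L`, and the interval `[u,v]`. The skeleton cuts along the FIRST one, at the
boundary between the two technologies that exist for the underlying objects (Λ and μ in one residue
class of modulus `m`): POINTWISE input for `m ≤ (log N)^C` (Siegel–Walfisz for Λ and for μ, both in
the tree: `Literature.NumberTheory.LFunctions.siegel_walfisz_holds`,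
`Literature.NumberTheory.LFunctions.SiegelWalfiszMoebius_holds`), and input ON AVERAGE OVER THE
MODULUS beyond (Bombieri–Vinogradov, tree: `Literature.NumberTheory.Sieve.bombieri_vinogradov_holds`;
dispersion). The two stubs:

* `stub_smallDilationsPointwise` (SW) — ONE dilation at a time in the Siegel–Walfisz range: for every
  `C`, eventually, `|S_Ψ(m; u, v)| ≤ N/(log N)^A` for each single `2 ≤ m ≤ (log N)^C`. This is the
  PARITY CORE: at `t = 1`, `Ψ = (n, n+h)`, `m = 2` it is `Σ_{p ≤ N, p ≡ −h (2)} μ((p+h)/2) log p = o`,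
  the Möbius–shifted-primes problem (tree conjecture
  `Literature.NumberTheory.Sieve.MoebiusShiftedPrimesConjecture` is its `m = 1` shadow; Lichtman 2020
  Thm 1.1 = tree fact `lichtman2020_moebius_shifted_primes_avg_holds` only on average over shifts),
  here for tuples, with a log-power saving, uniform in the shift and in a polylog modulus.
* `stub_largeDilationsMean` (BV) — the ℓ¹-MEAN over the power dilations beyond polylog: for SOME
  `C, δ > 0`, eventually, `Σ_{(log N)^C < m ≤ N^δ} log m · |S_Ψ(m; u, v)| ≤ N/(log N)^A`. No single
  fixed-modulus Möbius–shifted-prime statement is contained in it (every bounded `m` is excluded);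
  its content is that almost every dilation in the Bombieri–Vinogradov range of the modulus shows
  cancellation — at `t = 1` a Möbius-twisted Bombieri–Vinogradov / Titchmarsh-divisor-type sum
  `Σ_{m ∼ M} log m |Σ_{p ≤ N, p ≡ −h (m)} μ((p+h)/m) log p|`, `(log N)^C < M ≤ N^δ`
  (signed shadow: `Σ_p (log·1_{(M,2M]} ∗ μ)(p + h)`, cf. the dispersion treatments of `Σ_p τ(p−1)`).

Composition (`MobiusCofactorAtom_of`, sorry-free, `#print axioms` = [propext, Classical.choice,
Quot.sound]): take `C, δ, N₁` from (BV) at saving `A+1`; take `N₂` from (SW) at saving `A+2C+1` for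
that `C`; for `N ≥ max(N₁, N₂, ⌈e²⌉)` split `[1, N^δ] ⊆ [1, (log N)^C] ∪ ((log N)^C, N^δ]` (all terms
`log m·|S| ≥ 0`, NO order between the two cut points is needed — `atomSum_Icc_le_split`); on the
first block there are `≤ (log N)^C` dilations, each with weight `log m ≤ m − 1 ≤ (log N)^C` (and the
`m = 1` term vanishes), so it is `≤ (log N)^{2C}·N/(log N)^{A+2C+1} = N/(log N)^{A+1}`; the second
block is `≤ N/(log N)^{A+1}` by (BV); and `2N/(log N)^{A+1} ≤ N/(log N)^A` because `log N ≥ 2`.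

Why this cut and not another: (i) it is the cut between the two EXISTING input technologies for
the modulus of a progression (pointwise ≤ polylog / averaged beyond), so each stub names the regime a
known method owns for the Möbius-free analogue; (ii) both stubs are CONSEQUENCES of the crux (SW is
one term of the crux's sum with weight `log m ≥ log 2`, BV a sub-sum of non-negative terms), so the
skeleton is an honest partition `crux ⟺ SW ∧ BV` (up to the eventual inequality `(log N)^C ≤ N^δ`)
and adds no misstatement surface to a crux already vetted by a crux-attack refuter and two grounders;
(iii) neither stub gives the crux or the summit on its own — SW omits the ℓ¹ over `N^δ` moduli, BV
omits every bounded modulus, i.e. the Möbius–shifted-primes core (BC3 probes below). Cuts NOT taken: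
`t = 1` / `t ≥ 2` (a case split with no technique behind it); an exceptional-zero dichotomy (the
illusory-world half is plausibly FALSE for shifts `h ≡ 0 (mod q)`, see Barriers — it belongs in a
Disproof, not in a line); Vaughan/Heath-Brown Type I/II in `d = ψ_{t+1}(n)/m` (the identity itself
would have to be a sorried 'transfer' stub; the Type II piece is a trilinear prime-tuple sum with no
owner) — recorded for the crux planners.

BC3 probes (registrar's folder `bc/probesA.lean`, `bc/probesB.lean`; the stub statements copied
verbatim, the skeleton NOT imported; `set_option maxHeartbeats 400000`; 2026-08-17):
`example : Stub → MobiusCofactorAtom` and `example : Stub → _root_.GeneralizedHardyLittlewood` by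
`first | exact? | simpa | aesop` FAIL 4/4 ("unsolved goals"; "aesop: failed to prove the goal after
exhaustive search"), and FAIL 4/4 again with the stub's and the target's definitions unfolded first;
the converse probes `MobiusCofactorAtom → Stub` (true by the one-line arguments in (ii)) also fail
mechanically 2/2 — informational only.

Disproof used: none on file for this crux (`ledger crux ls stmt-Parity-13833`: no workfiles at
registration). The crux-attack evidence on the item (refuter, `Mutation.lean`, rc 0) PROVED
`¬(atom without IsNondegenerateSystem)` via `Ψ = (n; 2n)`, `m = 2` (inner sum `= −θ(N)`): BOTH stubs
keep `IsNondegenerateSystem Ψ` as a hypothesis, so the line honours that obstruction at each stub.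
Negatives index (`ledger negatives --problem Parity`, 2026-08-17: 3 refuted statements —
stmt-Parity-9541 sieve-sequence convolution moments, stmt-Parity-14832 `TupleElliott` (pretentious
level `A₀` fixed before `N`: shift-divisor blindness), stmt-Parity-4218 shifted-multiplication-table
rectangle Chowla): no stub restates one; the stubs quantify exactly as the crux does (`N₀` after
`t, L, A, C`), carry no pretentious-distance hypothesis, and are implied by the crux.

Barriers (catalogue `Literature/Barriers/Parity/`): `SelbergParityBarrier` / `PrimePairParity` —
both stubs are bilinear MÖBIUS statements (μ on the large complementary divisor `d = ψ_{t+1}(n)/m`),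
the non-sieve input those barriers say is necessary, not members of the Type-I class they kill;
`SiegelZeroPrimePairBarrier` (Goldston–Suriajaya 2021 / Matomäki–Merikoski 2023) — NOT evaded,
inherited from the crux: through the shift-uniformity `‖Ψ‖_N ≤ L` both stubs meet shifts `h ≡ 0`
modulo an exceptional modulus, where `μ(d) ≈ −χ(d)` would make `S_Ψ(m) ≈ χ̄(m)·(biased prime sum)`
of size `≍ N/φ(m)` with no cancellation — so each stub, like the crux (route header: "a proof entails
Landau–Siegel repulsion"), is at least as strong as a zero-repulsion statement at the corresponding
scales; `LargeSieveLevelHalf` — not engaged (`δ` is existential, any `δ < 1/2` will do);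
`EquidistributionLimitBarrier` / `FriedlanderGranvilleUniformity` — not engaged (no main terms, no
polylog co-level: the dilation range is a power `N^δ`, the modulus range of SW a polylog).

`lean check --json`: rc 0; `sorry` exactly in the two `stub_*` theorems (sorries = 2 = stubs, zero
elsewhere); `mobiusCofactorAtom_iff` certifies by `Iff.rfl` that the `atomSum`/`cofactorSum`
spelling below is the route decl's spelling.
-/

namespace Summit.Parity.GeneralizedHardyLittlewood.Cruxes.MobiusCofactorAtom.Birth

open Literature.NumberTheory.Sieve
open Summit.Parity.GeneralizedHardyLittlewood.Theses.ClassVarianceLadder (MobiusCofactorAtom)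
open scoped BigOperators Classical

noncomputable section

/-! ### Objects of the line (verbatim the crux's summands) -/

/-- The Möbius-cofactor sum at dilation `m`:
`S_Ψ(m; u, v) = Σ_{n ∈ [u,v], ψ_{t+1}(n) ≥ 1, m ∣ ψ_{t+1}(n)} μ(ψ_{t+1}(n)/m) · Π_{i ≤ t} Λ(ψ_i(n))`
(the inner sum of the crux, with `ψ_{t+1} = Ψ (Fin.last t)`; `μ` of the exact quotient in `ℕ`,
`Λ` on `ℤ` vanishing on `n ≤ 0`). -/
def cofactorSum (t : ℕ) (Ψ : Fin (t + 1) → AffLinForm 1) (u v : ℤ) (m : ℕ) : ℝ :=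
  ∑ n ∈ (Finset.Icc u v).filter (fun n : ℤ => 1 ≤ (Ψ (Fin.last t)).eval (fun _ => n) ∧
      (m : ℤ) ∣ (Ψ (Fin.last t)).eval (fun _ => n)),
    (ArithmeticFunction.moebius (((Ψ (Fin.last t)).eval (fun _ => n)).toNat / m) : ℝ) *
      ∏ i : Fin t, intVonMangoldt ((Ψ (Fin.castSucc i)).eval fun _ => n)

/-- The atom over a finite set `S` of dilations: `Σ_{m ∈ S} log m · |S_Ψ(m; u, v)|`
(the crux is the case `S = [1, N^δ]`). -/
def atomSum (t : ℕ) (Ψ : Fin (t + 1) → AffLinForm 1) (u v : ℤ) (S : Finset ℕ) : ℝ :=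
  ∑ m ∈ S, Real.log (m : ℝ) * |cofactorSum t Ψ u v m|

/-! ### The two stub statements -/

/-- (SW) **Pointwise atom in the Siegel–Walfisz range of the dilation.** For every `t ≥ 1`, `L`,
`A > 0`, `C > 0`, eventually in `N`, uniformly over non-degenerate systems `Ψ` of `t+1` forms with
`‖Ψ‖_N ≤ L`, intervals `[u,v] ⊆ [−N,N]` and SINGLE dilations `2 ≤ m ≤ (log N)^C`:
`|S_Ψ(m; u, v)| ≤ N/(log N)^A`. -/
def SmallDilationsPointwise : Prop :=
  ∀ t : ℕ, 1 ≤ t → ∀ (L : ℕ) (A C : ℝ), 0 < A → 0 < C → ∃ N₀ : ℕ, ∀ N : ℕ, N₀ ≤ N →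
    ∀ Ψ : Fin (t + 1) → AffLinForm 1, IsNondegenerateSystem Ψ → affLinSize Ψ N ≤ L →
      ∀ u v : ℤ, -(N : ℤ) ≤ u → v ≤ N → ∀ m : ℕ, 2 ≤ m → (m : ℝ) ≤ Real.log N ^ C →
        |cofactorSum t Ψ u v m| ≤ (N : ℝ) / Real.log N ^ A

/-- (BV) **Mean atom over the power dilations beyond polylog.** For every `t ≥ 1`, `L`, `A > 0`
there are `C > 0`, `δ > 0` such that, eventually in `N`, uniformly over `Ψ`, `[u,v]` as above:
`Σ_{(log N)^C < m ≤ N^δ} log m · |S_Ψ(m; u, v)| ≤ N/(log N)^A`. -/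
def LargeDilationsMean : Prop :=
  ∀ t : ℕ, 1 ≤ t → ∀ (L : ℕ) (A : ℝ), 0 < A → ∃ C : ℝ, 0 < C ∧ ∃ δ : ℝ, 0 < δ ∧ ∃ N₀ : ℕ,
    ∀ N : ℕ, N₀ ≤ N → ∀ Ψ : Fin (t + 1) → AffLinForm 1, IsNondegenerateSystem Ψ →
      affLinSize Ψ N ≤ L → ∀ u v : ℤ, -(N : ℤ) ≤ u → v ≤ N →
        atomSum t Ψ u v (Finset.Ioc ⌊Real.log N ^ C⌋₊ ⌊(N : ℝ) ^ δ⌋₊) ≤ (N : ℝ) / Real.log N ^ A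

/-! ### The registered stubs (the ONLY places `sorry` occurs) -/

/-- **Stub (SW): Möbius of the cofactor against the prime `t`-tuple, one dilation at a time, for
polylog dilations.** For every `t ≥ 1`, `L`, `A, C > 0`, eventually in `N`: for every non-degenerate
`Ψ = (ψ₁, …, ψ_{t+1})` on `ℤ` with `‖Ψ‖_N ≤ L`, every `[u,v] ⊆ [−N,N]` and every single
`2 ≤ m ≤ (log N)^C`,
`|Σ_{n ∈ [u,v], ψ_{t+1}(n) ≥ 1, m ∣ ψ_{t+1}(n)} μ(ψ_{t+1}(n)/m) Π_{i ≤ t} Λ(ψ_i(n))| ≤ N/(log N)^A`.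
Informally: writing `ψ_{t+1}(n) = m d`, `d` runs over an interval of length `≍ LN/m` and the sum is
`Σ_d μ(d)·(Λ-weight of the t-tuple at n = n(m, d))` — at `t = 1`, `Ψ = (n, n+h)`:
`Σ_{p ≤ N, p ≡ −h (m)} μ((p+h)/m) log p`, Möbius on shifted primes in ONE progression of polylog
modulus, with a `(log N)^A` saving, uniform in `|h| ≤ LN`. Why plausibly true: Chowla/Elliott-type
orthogonality of `μ` of one affine image to any function of the primality of the others; `m ≤ (log
N)^C` is the range where pointwise Siegel–Walfisz input for `Λ` and for `μ` exists (tree: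
`siegel_walfisz_holds`, `SiegelWalfiszMoebius_holds`); conjecturally true with a power saving absent
exceptional zeros. Why it might fail / what it costs: it CONTAINS the Möbius–shifted-primes problem
(`m = 2`, `t = 1`, each fixed `h` — open; Murty–Vatwani only under a zero-free hypothesis, Lichtman /
Lichtman–Teräväinen only on average over shifts or scales); the shift-uniformity meets `h ≡ 0`
modulo an exceptional modulus, where the bound is as strong as Landau–Siegel repulsion
(SiegelZeroPrimePairBarrier; Heath-Brown 1983 / Matomäki–Merikoski 2023 describe the illusory
world). Technique bet: entropy-decrement / pretentious methods (Tao's two-point log-Chowla,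
Matomäki–Radziwiłł–Tao, Tao–Teräväinen) transported to the shifted-prime weight as in Lichtman 2020,
plus a Deuring–Heilbronn case analysis for the exceptional shifts. Size: open-problem (the parity
core of the crux). Sources: Literature.NumberTheory.Sieve.MoebiusShiftedPrimesConjecture,
Lichtman2020 (Thm 1.1), LichtmanTeravainen2022, MurtyVatwani2017, Vatwani2016,
MatomakiRadziwillTao2015, HeathBrown1983PrimeTwins, MatomakiMerikoski2023 (Thm 1.3),
Harman2007 (§14.2), Literature.Barriers.Parity.SiegelZeroPrimePairBarrier. -/
theorem stub_smallDilationsPointwise : SmallDilationsPointwise := by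
  sorry

/-- **Stub (BV): the ℓ¹-mean of the atom over the power dilations beyond polylog.** For every
`t ≥ 1`, `L`, `A > 0` there are `C > 0`, `δ > 0`, `N₀` with: for `N ≥ N₀`, every non-degenerate `Ψ`
of `t+1` forms with `‖Ψ‖_N ≤ L`, every `[u,v] ⊆ [−N,N]`,
`Σ_{(log N)^C < m ≤ N^δ} log m · |S_Ψ(m; u, v)| ≤ N/(log N)^A`.
Informally: beyond the Siegel–Walfisz range there is no pointwise input even for `Λ` alone in one
progression of modulus `m`, so this block must be won ON AVERAGE over the dilation — the
Bombieri–Vinogradov range of the modulus (`(log N)^C < m ≤ N^δ`, any `δ > 0` of the prover's choosing,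
inner sums of length `≍ LN/m`, `≤ log N` dyadic blocks, demanded saving `(log N)^{A+t+2}` over the
trivial bound per block); at `t = 1`: `Σ_{m ∼ M} log m |Σ_{p ≤ N, p ≡ −h (m)} μ((p+h)/m) log p|`, a
Möbius-twisted Bombieri–Vinogradov / Titchmarsh-divisor-type mean (signed shadow
`Σ_p (log·1_{(M,2M]} ∗ μ)(p+h)`, the object of Linnik's dispersion method, Bombieri–Friedlander–Iwaniec,
Drappeau). Why plausibly true: implied by the crux (a sub-sum of non-negative terms); GRH-type
heuristics give square-root cancellation in each `S_Ψ(m)` for `m ≤ N^{1/2−ε}`, and the stub only asks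
a log-power saving for almost all `m`, with `δ` as small as desired. Why it might fail / what it
costs: the absolute values sit INSIDE the `m`-sum, so no cancellation across dilations is available
and almost every `S_Ψ(m)` must cancel on its own; after Cauchy–Schwarz in `d` the off-diagonal is a
correlation of `2t` von Mangoldt factors along linear forms in the dilation variable (an HL-type sum),
so the classical dispersion method does not close as it stands, and Type I/II decompositions of
`μ(d)` leave trilinear sums with prime-tuple weights; the exceptional-shift caveat of (SW) applies
verbatim. Technique bet: large sieve / dispersion in the `m`-aspect with the tuple weight expanded by
an upper-bound sieve majorant (enough for almost-all-`m` statements), Bombieri's asymptotic-sieve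
bookkeeping (Murty–Vatwani treat exactly the Möbius range `d ≤ x^{1−ε}` conditionally). Size: open
(L–XL already at `t = 1`). Sources: BombieriAsymptoticSieve1976, MurtyVatwani2017, Vatwani2016,
BombieriFriedlanderIwaniecActa1986, Drappeau2017, IwaniecKowalski2004 (dispersion method, Ch. 17
Bombieri–Vinogradov), Literature.NumberTheory.Sieve.bombieri_vinogradov (tree, proved),
Literature.Barriers.Parity.SiegelZeroPrimePairBarrier. -/
theorem stub_largeDilationsMean : LargeDilationsMean := by
  sorry

/-! ### Name-keyed aliases of the two stub statements — the hypotheses of `MobiusCofactorAtom_of`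

The native skeleton audit (`#h21_check_skeleton`, run by `ledger skeleton check`) admits a hypothesis of the
composing theorem only if its head constant is a registered obligation or is NAMED like a declared stub;
`__Registered.stub_X` is the statement of `stub_X` under the stub's short name (device of
`AnomalousDissipation/…/Cruxes/CyclicWindLineLoud/Lines/birth.lean`,
`AtomisticToContinuum/…/Cruxes/AmplitudeLDP/Lines/birth.lean`; the `__` namespace is an implementation
detail, so the audit's stub report resolves each `stub_…` to the sorried theorem above, not to its alias;
the gate-reserved `@[stub]` attribute is not written by a planner). Each alias is `rfl`-equal to its
statement. -/
namespace __Registered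

/-- Alias of `SmallDilationsPointwise` keyed by the registered stub name. -/
abbrev stub_smallDilationsPointwise : Prop := SmallDilationsPointwise
/-- Alias of `LargeDilationsMean` keyed by the registered stub name. -/
abbrev stub_largeDilationsMean : Prop := LargeDilationsMean

end __Registered

/-! ### Sorry-free glue -/

/-- The `atomSum` spelling of the crux is definitionally the route's spelling. [folklore] -/
theorem mobiusCofactorAtom_iff :
    MobiusCofactorAtom ↔
      ∀ t : ℕ, 1 ≤ t → ∀ (L : ℕ) (A : ℝ), 0 < A → ∃ δ : ℝ, 0 < δ ∧ ∃ N₀ : ℕ, ∀ N : ℕ, N₀ ≤ N →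
        ∀ Ψ : Fin (t + 1) → AffLinForm 1, IsNondegenerateSystem Ψ → affLinSize Ψ N ≤ L →
          ∀ u v : ℤ, -(N : ℤ) ≤ u → v ≤ N →
            atomSum t Ψ u v (Finset.Icc 1 ⌊(N : ℝ) ^ δ⌋₊) ≤ (N : ℝ) / Real.log N ^ A :=
  Iff.rfl

/-- Each atom summand is non-negative on dilations `m ≥ 1`. [folklore] -/
theorem atomTerm_nonneg (t : ℕ) (Ψ : Fin (t + 1) → AffLinForm 1) (u v : ℤ) {m : ℕ}
    (hm : 1 ≤ m) : 0 ≤ Real.log (m : ℝ) * |cofactorSum t Ψ u v m| :=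
  mul_nonneg (Real.log_nonneg (by exact_mod_cast hm)) (abs_nonneg _)

/-- Splitting the dilation range `[1, n] ⊆ [1, K] ∪ (K, n]` (no order between `K` and `n` needed). [folklore] -/
theorem atomSum_Icc_le_split (t : ℕ) (Ψ : Fin (t + 1) → AffLinForm 1) (u v : ℤ) (K n : ℕ) :
    atomSum t Ψ u v (Finset.Icc 1 n) ≤
      atomSum t Ψ u v (Finset.Icc 1 K) + atomSum t Ψ u v (Finset.Ioc K n) := by
  unfold atomSum
  have hdisj : Disjoint (Finset.Icc 1 K) (Finset.Ioc K n) := by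
    rw [Finset.disjoint_left]
    intro m h1 h2
    simp only [Finset.mem_Icc] at h1
    simp only [Finset.mem_Ioc] at h2
    omega
  rw [← Finset.sum_union hdisj]
  refine Finset.sum_le_sum_of_subset_of_nonneg ?_ ?_
  · intro m hm
    simp only [Finset.mem_Icc] at hm
    simp only [Finset.mem_union, Finset.mem_Icc, Finset.mem_Ioc]
    omega
  · intro m hm _
    have hm1 : 1 ≤ m := by
      simp only [Finset.mem_union, Finset.mem_Icc, Finset.mem_Ioc] at hm
      omega
    exact atomTerm_nonneg t Ψ u v hm1

/-- `log N ≥ 2` once `N ≥ ⌈e²⌉`. [folklore] -/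
theorem two_le_log_of_le {N : ℕ} (hN : ⌈Real.exp 2⌉₊ ≤ N) : 2 ≤ Real.log N := by
  have h1 : Real.exp 2 ≤ (N : ℝ) := (Nat.le_ceil (Real.exp 2)).trans (by exact_mod_cast hN)
  have hpos : (0 : ℝ) < N := (Real.exp_pos 2).trans_le h1
  exact (Real.le_log_iff_exp_le hpos).mpr h1

/-- **THE SKELETON THEOREM (hypothesis form, real proof).** The two stub statements (as the name-keyed
aliases `__Registered.stub_*`, each `rfl`-equal to its statement) prove the crux
`Summit.Parity.GeneralizedHardyLittlewood.Theses.ClassVarianceLadder.MobiusCofactorAtom` BY NAME: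
take `C, δ` from (BV) at saving `A+1`, apply (SW) at saving `A+2C+1` on `2 ≤ m ≤ (log N)^C`
(at most `(log N)^C` dilations, each weighted by `log m ≤ (log N)^C`), and absorb the factor `2`
into one logarithm (`log N ≥ 2`). [folklore] -/
theorem MobiusCofactorAtom_of :
    __Registered.stub_smallDilationsPointwise → __Registered.stub_largeDilationsMean →
      MobiusCofactorAtom := by
  intro hS hB
  change SmallDilationsPointwise at hS
  change LargeDilationsMean at hB
  rw [mobiusCofactorAtom_iff]
  intro t ht L A hA
  obtain ⟨C, hC, δ, hδ, N₁, hB'⟩ := hB t ht L (A + 1) (by linarith)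
  obtain ⟨N₂, hS'⟩ := hS t ht L (A + 2 * C + 1) C (by linarith) hC
  refine ⟨δ, hδ, max N₁ (max N₂ ⌈Real.exp 2⌉₊), ?_⟩
  intro N hN Ψ hΨ hsize u v hu hv
  have hN1 : N₁ ≤ N := le_trans (le_max_left _ _) hN
  have hN2 : N₂ ≤ N := le_trans ((le_max_left _ _).trans (le_max_right _ _)) hN
  have hN3 : ⌈Real.exp 2⌉₊ ≤ N := le_trans ((le_max_right _ _).trans (le_max_right _ _)) hN
  have hlog2 : 2 ≤ Real.log N := two_le_log_of_le hN3
  have hlogpos : 0 < Real.log N := by linarith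
  have hNpos : (0 : ℝ) < N := by
    have h1 : Real.exp 2 ≤ (N : ℝ) := (Nat.le_ceil (Real.exp 2)).trans (by exact_mod_cast hN3)
    exact (Real.exp_pos 2).trans_le h1
  set ℓ : ℝ := Real.log N with hℓ
  -- the large-dilation block
  have hlarge : atomSum t Ψ u v (Finset.Ioc ⌊ℓ ^ C⌋₊ ⌊(N : ℝ) ^ δ⌋₊) ≤ (N : ℝ) / ℓ ^ (A + 1) :=
    hB' N hN1 Ψ hΨ hsize u v hu hv
  -- the small-dilation block, term by term
  have hKle : ((⌊ℓ ^ C⌋₊ : ℕ) : ℝ) ≤ ℓ ^ C := Nat.floor_le (Real.rpow_nonneg hlogpos.le C)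
  have hterm : ∀ m ∈ Finset.Icc 1 ⌊ℓ ^ C⌋₊,
      Real.log (m : ℝ) * |cofactorSum t Ψ u v m| ≤ ℓ ^ C * ((N : ℝ) / ℓ ^ (A + 2 * C + 1)) := by
    intro m hm
    rw [Finset.mem_Icc] at hm
    have hmle : (m : ℝ) ≤ ℓ ^ C := le_trans (by exact_mod_cast hm.2) hKle
    have hbound_nonneg : 0 ≤ ℓ ^ C * ((N : ℝ) / ℓ ^ (A + 2 * C + 1)) := by positivity
    rcases Nat.lt_or_ge m 2 with hm1 | hm2
    · -- m = 1: the weight `log 1` vanishes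
      have : m = 1 := by omega
      subst this
      simp [hbound_nonneg]
    · have hSm : |cofactorSum t Ψ u v m| ≤ (N : ℝ) / ℓ ^ (A + 2 * C + 1) :=
        hS' N hN2 Ψ hΨ hsize u v hu hv m hm2 hmle
      have hmpos : (0 : ℝ) < m := by exact_mod_cast (show 0 < m by omega)
      have hlogm : Real.log (m : ℝ) ≤ ℓ ^ C := by
        have := Real.log_le_sub_one_of_pos hmpos
        linarith
      have hlogm0 : 0 ≤ Real.log (m : ℝ) := Real.log_nonneg (by exact_mod_cast (show 1 ≤ m by omega))
      exact mul_le_mul hlogm hSm (abs_nonneg _) (Real.rpow_nonneg hlogpos.le C)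
  have hsmall : atomSum t Ψ u v (Finset.Icc 1 ⌊ℓ ^ C⌋₊) ≤ (N : ℝ) / ℓ ^ (A + 1) := by
    unfold atomSum
    refine (Finset.sum_le_card_nsmul _ _ _ hterm).trans ?_
    rw [Nat.card_Icc, nsmul_eq_mul]
    have hcard : (((⌊ℓ ^ C⌋₊ + 1 - 1 : ℕ)) : ℝ) ≤ ℓ ^ C := by
      rw [Nat.add_sub_cancel]
      exact hKle
    have hsplit : ℓ ^ (A + 2 * C + 1) = ℓ ^ (A + 1) * (ℓ ^ C * ℓ ^ C) := by
      rw [show A + 2 * C + 1 = (A + 1) + (C + C) by ring, Real.rpow_add hlogpos (A + 1) (C + C),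
        Real.rpow_add hlogpos C C]
    have hA1pos : 0 < ℓ ^ (A + 1) := Real.rpow_pos_of_pos hlogpos _
    have hCpos : 0 < ℓ ^ C := Real.rpow_pos_of_pos hlogpos _
    calc (((⌊ℓ ^ C⌋₊ + 1 - 1 : ℕ)) : ℝ) * (ℓ ^ C * ((N : ℝ) / ℓ ^ (A + 2 * C + 1)))
        ≤ ℓ ^ C * (ℓ ^ C * ((N : ℝ) / ℓ ^ (A + 2 * C + 1))) :=
          mul_le_mul_of_nonneg_right hcard (by positivity)
      _ = (N : ℝ) / ℓ ^ (A + 1) := by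
          rw [hsplit]
          field_simp
  -- assemble: two blocks of size N/(log N)^(A+1) each, and 2 ≤ log N
  have hsum := atomSum_Icc_le_split t Ψ u v ⌊ℓ ^ C⌋₊ ⌊(N : ℝ) ^ δ⌋₊
  have hfinal : (N : ℝ) / ℓ ^ (A + 1) + (N : ℝ) / ℓ ^ (A + 1) ≤ (N : ℝ) / ℓ ^ A := by
    rw [Real.rpow_add_one hlogpos.ne' A]
    have hApos : 0 < ℓ ^ A := Real.rpow_pos_of_pos hlogpos _
    rw [← add_div, div_le_div_iff₀ (mul_pos hApos hlogpos) hApos]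
    nlinarith [mul_pos hNpos hApos]
  linarith [hsum, hsmall, hlarge, hfinal]

/-- **The crux BY NAME from the two registered stubs.** [folklore] -/
theorem MobiusCofactorAtom_of_stubs : MobiusCofactorAtom :=
  MobiusCofactorAtom_of stub_smallDilationsPointwise stub_largeDilationsMean

end

end Summit.Parity.GeneralizedHardyLittlewood.Cruxes.MobiusCofactorAtom.Birth
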